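import Summits.Ventures.HodgeRepro.RectQuad6

/-!
# The involution-rectangle mechanism for every odd `k`: `Δ = {1, u, v, uv}`, `u` an involution, `v` of order `2k`

Blind re-derivation cell `pub-hodge-repro`, seat `p1` (gen 10).  The general level of `RectQuad6.lean`: for EVERY
finite group `G` with a complex conjugation `c`, every involution `u ∉ {1, c}` and every `w` of ODD order `k ≥ 3`
commuting with `u`, if `8k ≤ |G|` then some CM type `Φ` has `Φ, Φu, Φ(wc), Φ(uwc)` `SumTwo` without a conjugate
pair (`exists_rectQuad_odd`; `v = wc` has order `2k`, `v^k = c`).  The local group is `W = ℤ/2 × ℤ/k × ℤ/2`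
(`u = (1,0,0)`, `w = (0,1,0)`, `c = (0,0,1)`), the two local solutions are the same two patterns as at `k = 3` —
type A `[i = 1] ⊕ [e = 1] ⊕ [a = 0]` (stable under `uc` only) and type B `[e = 1]` (the induced type, stable under
`vc`, `uvc`, `u v⁻¹ c` only) — and the three local conditions of `exists_quad_of_pattern` are now proved by hand
(the `ℤ/2` parts by `decide`, the `ℤ/k` part through `1 ≠ 0`, `2 ≠ 0` in `ℤ/k`, `k ≥ 3`).  `k` odd is used exactly
twice: for the injectivity of `(i, a, e) ↦ uⁱ wᵃ cᵉ` (squaring gives `w^{2a} = 1`, so `k ∣ a` by coprimality) and,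
implicitly, in the CM condition of type B (`[e = 1]` flips under `c` because `c` lives in the `ℤ/2` factor — in
the non-CRT picture `C_{2k}` this is `j + k` odd ⟺ `j` even, which needs `k` odd).

New instances beyond `k = 3`: `(C₂ × C₂₀, (0,10))` (`k = 5`), `(C₂ × C₂₈, (0,14))` (`k = 7`), `(C₂ × C₃₀, (1,0))`
and `(1,15)` (`k = 5`), and in general every abelian `(G, c)` with a second involution `u ≠ c` and an element of
odd order `k ≥ 3`, once `|G| ≥ 8k`.
-/

set_option autoImplicit false

open Finset
open scoped Pointwise

namespace HodgeRepro.CosetQuad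

variable {G : Type*} [Group G]

/-! ### Two counting lemmas on `Fin 4` -/

/-- Exactly two of `b, ¬b, b', ¬b'` hold. -/
theorem card_filter_vecA (b₀ b₂ : Bool) :
    (univ.filter fun j : Fin 4 => ![b₀, !b₀, b₂, !b₂] j = true).card = 2 := by
  cases b₀ <;> cases b₂ <;> decide

/-- Exactly two of `b, b, ¬b, ¬b` hold. -/
theorem card_filter_vecB (b : Bool) :
    (univ.filter fun j : Fin 4 => ![b, b, !b, !b] j = true).card = 2 := by
  cases b <;> decide

section RectOdd

variable (k : ℕ) [NeZero k]

/-- The abstract group `ℤ/2 × ℤ/k × ℤ/2` of the involution-rectangle mechanism. -/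
abbrev PR : Type := Multiplicative (ZMod 2) × (Multiplicative (ZMod k) × Multiplicative (ZMod 2))

/-- The hom `ℤ/2 × ℤ/k × ℤ/2 →* G`, `(i, a, e) ↦ uⁱ wᵃ cᵉ`, for a complex conjugation `c`, an involution `u`
commuting with `w`, and `w` of order `k`. -/
def rectHom {c : G} (hc : IsComplexConj c) {u w : G} (hu : u * u = 1) (hw : orderOf w = k)
    (huw : u * w = w * u) : PR k →* G :=
  (zmodPowHom 2 u (by rw [pow_two, hu])).noncommCoprod
    ((zmodPowHom k w (by rw [← hw, pow_orderOf_eq_one])).noncommCoprod (zmodPowHom 2 c (conj_sq_eq_one hc))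
      fun _ _ => Commute.pow_pow (hc.comm w).symm _ _)
    fun _ _ => Commute.mul_right (Commute.pow_pow huw _ _) (Commute.pow_pow (hc.comm u).symm _ _)

/-- `rectHom (i, a, e) = uⁱ wᵃ cᵉ`. -/
theorem rectHom_apply {c : G} (hc : IsComplexConj c) {u w : G} (hu : u * u = 1) (hw : orderOf w = k)
    (huw : u * w = w * u) (p : PR k) :
    rectHom k hc hu hw huw p = u ^ (Multiplicative.toAdd p.1).val *
      (w ^ (Multiplicative.toAdd p.2.1).val * c ^ (Multiplicative.toAdd p.2.2).val) := rfl

/-- `rectHom` is injective when `k` is odd and `u ∉ {1, c}`: squaring `uⁱ wᵃ cᵉ = 1` gives `w^{2a} = 1`, so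
`k ∣ 2a`, `k ∣ a` (`k` odd), `a = 0`; then `uⁱ cᵉ = 1` forces `i = e = 0`. -/
theorem rectHom_injective (hodd : Odd k) {c : G} (hc : IsComplexConj c) {u w : G} (hu : u * u = 1)
    (hw : orderOf w = k) (huw : u * w = w * u) (hu1 : u ≠ 1) (huc : u ≠ c) :
    Function.Injective (rectHom k hc hu hw huw) := by
  rw [injective_iff_map_eq_one]
  rintro ⟨i, a, e⟩ hp
  rw [rectHom_apply] at hp
  dsimp only at hp
  have hi2 := ZMod.val_lt (Multiplicative.toAdd i)
  have hak := ZMod.val_lt (Multiplicative.toAdd a)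
  have he2 := ZMod.val_lt (Multiplicative.toAdd e)
  set I := (Multiplicative.toAdd i).val with hI
  set A := (Multiplicative.toAdd a).val with hA
  set E := (Multiplicative.toAdd e).val with hE
  have hcomm1 : Commute (u ^ I) (w ^ A * c ^ E) :=
    Commute.mul_right (Commute.pow_pow huw _ _) (Commute.pow_pow (hc.comm u).symm _ _)
  have hcomm2 : Commute (w ^ A) (c ^ E) := Commute.pow_pow (hc.comm w).symm _ _
  have hsq : w ^ (2 * A) = 1 := by
    have h : (u ^ I * (w ^ A * c ^ E)) ^ 2 = 1 := by rw [hp, one_pow]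
    rw [hcomm1.mul_pow, hcomm2.mul_pow, ← pow_mul, ← pow_mul, ← pow_mul, mul_comm I 2, pow_mul u 2 I,
      pow_two u, hu, one_pow, one_mul, mul_comm E 2, pow_mul c 2 E, pow_two c, hc.mul_self, one_pow,
      mul_one, mul_comm A 2] at h
    exact h
  have hdvd : orderOf w ∣ 2 * A := orderOf_dvd_of_pow_eq_one hsq
  rw [hw, mul_comm] at hdvd
  have hkA : k ∣ A := Nat.Coprime.dvd_of_dvd_mul_right hodd.coprime_two_right hdvd
  have hA0 : A = 0 := by
    rcases Nat.eq_zero_or_pos A with h | h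
    · exact h
    · exact absurd (Nat.le_of_dvd h hkA) (not_le.2 hak)
  rw [hA0, pow_zero, one_mul] at hp
  have key : I = 0 ∧ E = 0 := by
    have hiv : I = 0 ∨ I = 1 := by omega
    have hev : E = 0 ∨ E = 1 := by omega
    rcases hiv with hi | hi <;> rcases hev with he | he <;> rw [hi, he] at hp <;>
      simp only [pow_zero, pow_one, one_mul, mul_one] at hp
    · exact ⟨hi, he⟩
    · exact absurd hp hc.ne_one
    · exact absurd hp hu1
    · exact absurd ((eq_inv_of_mul_eq_one_left hp).trans hc.inv_eq) huc
  have hi : i = 1 := by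
    rw [← ofAdd_toAdd i, (ZMod.val_eq_zero _).1 key.1, ofAdd_zero]
  have ha : a = 1 := by
    rw [← ofAdd_toAdd a, (ZMod.val_eq_zero _).1 hA0, ofAdd_zero]
  have he : e = 1 := by
    rw [← ofAdd_toAdd e, (ZMod.val_eq_zero _).1 key.2, ofAdd_zero]
  rw [hi, ha, he]
  rfl

/-- The twists `1, (1,0,0), (0,1,1), (1,1,1)`, mapped to `1, u, wc, uwc`. -/
def rectTwist (i : Fin 4) : PR k :=
  ![(1, 1, 1), (Multiplicative.ofAdd 1, 1, 1), (1, Multiplicative.ofAdd 1, Multiplicative.ofAdd 1),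
    (Multiplicative.ofAdd 1, Multiplicative.ofAdd 1, Multiplicative.ofAdd 1)] i

/-- The element `(0, 0, 1)` of `PR k`, mapped to `c`. -/
def rectConj : PR k := (1, 1, Multiplicative.ofAdd 1)

/-- `rectHom rectConj = c`. -/
theorem rectHom_conj {c : G} (hc : IsComplexConj c) {u w : G} (hu : u * u = 1) (hw : orderOf w = k)
    (huw : u * w = w * u) : rectHom k hc hu hw huw (rectConj k) = c := by
  rw [rectHom_apply]
  show u ^ (0 : ZMod 2).val * (w ^ (0 : ZMod k).val * c ^ (1 : ZMod 2).val) = c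
  simp only [ZMod.val_zero, val_one_two, pow_zero, pow_one, one_mul]

/-- `rectQuad Φ u w c` is the quadruple of twists by the `rectHom (rectTwist i)` (for `1 < k`). -/
theorem rectQuad_eq_twists_odd (hk1 : 1 < k) (Φ : Finset G) {c : G} (hc : IsComplexConj c) {u w : G}
    (hu : u * u = 1) (hw : orderOf w = k) (huw : u * w = w * u) :
    rectQuad Φ u w c = fun i => rmul Φ (rectHom k hc hu hw huw (rectTwist k i)) := by
  haveI : Fact (1 < k) := ⟨hk1⟩
  funext i
  rw [rectHom_apply]
  fin_cases i
  · show Φ = rmul Φ (u ^ (0 : ZMod 2).val * (w ^ (0 : ZMod k).val * c ^ (0 : ZMod 2).val))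
    simp only [ZMod.val_zero, pow_zero, one_mul, rmul_one]
  · show rmul Φ u = rmul Φ (u ^ (1 : ZMod 2).val * (w ^ (0 : ZMod k).val * c ^ (0 : ZMod 2).val))
    simp only [ZMod.val_zero, val_one_two, pow_zero, pow_one, mul_one]
  · show rmul Φ (w * c) =
      rmul Φ (u ^ (0 : ZMod 2).val * (w ^ (1 : ZMod k).val * c ^ (1 : ZMod 2).val))
    simp only [ZMod.val_zero, val_one_two, ZMod.val_one, pow_zero, pow_one, one_mul]
  · show rmul Φ (u * (w * c)) =
      rmul Φ (u ^ (1 : ZMod 2).val * (w ^ (1 : ZMod k).val * c ^ (1 : ZMod 2).val))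
    simp only [val_one_two, ZMod.val_one, pow_one]

/-- The two local solutions as a pattern on `PR k`: label `0` = type A `[i = 1] ⊕ [e = 1] ⊕ [a = 0]`,
label `1` = type B `[e = 1]`. -/
def rectPattern (l : Fin 2) (p : PR k) : Bool :=
  if l = 0 then
    xor (xor (decide (Multiplicative.toAdd p.1 = 1)) (decide (Multiplicative.toAdd p.2.2 = 1)))
      (decide (Multiplicative.toAdd p.2.1 = 0))
  else decide (Multiplicative.toAdd p.2.2 = 1)

omit [NeZero k] in
/-- Type A at a point. -/
theorem rectPattern_zero (i : Multiplicative (ZMod 2)) (a : Multiplicative (ZMod k))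
    (e : Multiplicative (ZMod 2)) :
    rectPattern k 0 (i, a, e) = xor (xor (decide (Multiplicative.toAdd i = 1))
      (decide (Multiplicative.toAdd e = 1))) (decide (Multiplicative.toAdd a = 0)) := by
  simp [rectPattern]

omit [NeZero k] in
/-- Type B at a point. -/
theorem rectPattern_one (i : Multiplicative (ZMod 2)) (a : Multiplicative (ZMod k))
    (e : Multiplicative (ZMod 2)) :
    rectPattern k 1 (i, a, e) = decide (Multiplicative.toAdd e = 1) := by
  simp [rectPattern]

/-! ### The three local conditions -/

/-- `[x + 1 = 1] = ¬[x = 1]` in `ℤ/2`. -/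
theorem zmod2_add_one (x : ZMod 2) : decide (x + 1 = 1) = !decide (x = 1) := by
  revert x; decide

/-- `[x + (-1) = 1] = ¬[x = 1]` in `ℤ/2`. -/
theorem zmod2_add_neg_one (x : ZMod 2) : decide (x + -1 = 1) = !decide (x = 1) := by
  revert x; decide

omit [NeZero k] in
/-- The CM condition of both patterns: multiplying by `rectConj = (0, 0, 1)` flips the value. -/
theorem rectPattern_conj (l : Fin 2) (p : PR k) :
    rectPattern k l (p * rectConj k) = !rectPattern k l p := by
  rcases p with ⟨i, a, e⟩
  have hx : ∀ X Y Z : Bool, xor (xor X (!Y)) Z = !xor (xor X Y) Z := by decide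
  fin_cases l
  · show rectPattern k 0 (i * 1, a * 1, e * Multiplicative.ofAdd 1) = !rectPattern k 0 (i, a, e)
    rw [mul_one, mul_one, rectPattern_zero, rectPattern_zero, toAdd_mul, toAdd_ofAdd, zmod2_add_one, hx]
  · show rectPattern k 1 (i * 1, a * 1, e * Multiplicative.ofAdd 1) = !rectPattern k 1 (i, a, e)
    rw [mul_one, mul_one, rectPattern_one, rectPattern_one, toAdd_mul, toAdd_ofAdd, zmod2_add_one]

omit [NeZero k] in
/-- The four translates `p (t j)⁻¹`, `j = 0, 1, 2, 3`, written out. -/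
theorem mul_rectTwist_inv (i : Multiplicative (ZMod 2)) (a : Multiplicative (ZMod k))
    (e : Multiplicative (ZMod 2)) :
    ((i, a, e) * (rectTwist k 0)⁻¹ = (i, a, e)) ∧
    ((i, a, e) * (rectTwist k 1)⁻¹ = (i * Multiplicative.ofAdd (-1), a, e)) ∧
    ((i, a, e) * (rectTwist k 2)⁻¹ = (i, a * Multiplicative.ofAdd (-1), e * Multiplicative.ofAdd (-1))) ∧
    ((i, a, e) * (rectTwist k 3)⁻¹ =
      (i * Multiplicative.ofAdd (-1), a * Multiplicative.ofAdd (-1), e * Multiplicative.ofAdd (-1))) := by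
  refine ⟨?_, ?_, ?_, ?_⟩
  · show (i, a, e) * (1, 1, 1)⁻¹ = (i, a, e)
    simp only [Prod.inv_mk, inv_one, Prod.mk_mul_mk, mul_one]
  · show (i, a, e) * (Multiplicative.ofAdd 1, 1, 1)⁻¹ = (i * Multiplicative.ofAdd (-1), a, e)
    simp only [Prod.inv_mk, inv_one, Prod.mk_mul_mk, mul_one, ofAdd_neg]
  · show (i, a, e) * (1, Multiplicative.ofAdd 1, Multiplicative.ofAdd 1)⁻¹ =
      (i, a * Multiplicative.ofAdd (-1), e * Multiplicative.ofAdd (-1))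
    simp only [Prod.inv_mk, inv_one, Prod.mk_mul_mk, mul_one, ofAdd_neg]
  · show (i, a, e) * (Multiplicative.ofAdd 1, Multiplicative.ofAdd 1, Multiplicative.ofAdd 1)⁻¹ =
      (i * Multiplicative.ofAdd (-1), a * Multiplicative.ofAdd (-1), e * Multiplicative.ofAdd (-1))
    simp only [Prod.inv_mk, Prod.mk_mul_mk, ofAdd_neg]

omit [NeZero k] in
/-- `SumTwo` of both patterns: exactly two of the four translates lie in the type. -/
theorem rectPattern_card (l : Fin 2) (p : PR k) :
    (univ.filter fun j : Fin 4 => rectPattern k l (p * (rectTwist k j)⁻¹) = true).card = 2 := by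
  rcases p with ⟨i, a, e⟩
  obtain ⟨h0, h1, h2, h3⟩ := mul_rectTwist_inv k i a e
  have hx : ∀ X Y Z : Bool, xor (xor (!X) Y) Z = !xor (xor X Y) Z := by decide
  fin_cases l
  · -- type A: values `b, ¬b, b', ¬b'`
    refine Eq.trans ?_ (card_filter_vecA (rectPattern k 0 (i, a, e))
      (rectPattern k 0 (i, a * Multiplicative.ofAdd (-1), e * Multiplicative.ofAdd (-1))))
    congr 1
    apply Finset.filter_congr
    intro j _
    fin_cases j
    · show rectPattern k 0 ((i, a, e) * (rectTwist k 0)⁻¹) = true ↔ rectPattern k 0 (i, a, e) = true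
      rw [h0]
    · show rectPattern k 0 ((i, a, e) * (rectTwist k 1)⁻¹) = true ↔
        (!rectPattern k 0 (i, a, e)) = true
      rw [h1, rectPattern_zero, rectPattern_zero, toAdd_mul, toAdd_ofAdd, zmod2_add_neg_one, hx]
    · show rectPattern k 0 ((i, a, e) * (rectTwist k 2)⁻¹) = true ↔
        rectPattern k 0 (i, a * Multiplicative.ofAdd (-1), e * Multiplicative.ofAdd (-1)) = true
      rw [h2]
    · show rectPattern k 0 ((i, a, e) * (rectTwist k 3)⁻¹) = true ↔
        (!rectPattern k 0 (i, a * Multiplicative.ofAdd (-1), e * Multiplicative.ofAdd (-1))) = true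
      rw [h3, rectPattern_zero, rectPattern_zero, toAdd_mul i, toAdd_ofAdd, zmod2_add_neg_one, hx]
  · -- type B: values `b, b, ¬b, ¬b`
    refine Eq.trans ?_ (card_filter_vecB (rectPattern k 1 (i, a, e)))
    congr 1
    apply Finset.filter_congr
    intro j _
    fin_cases j
    · show rectPattern k 1 ((i, a, e) * (rectTwist k 0)⁻¹) = true ↔ rectPattern k 1 (i, a, e) = true
      rw [h0]
    · show rectPattern k 1 ((i, a, e) * (rectTwist k 1)⁻¹) = true ↔ rectPattern k 1 (i, a, e) = true
      rw [h1, rectPattern_one, rectPattern_one]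
    · show rectPattern k 1 ((i, a, e) * (rectTwist k 2)⁻¹) = true ↔
        (!rectPattern k 1 (i, a, e)) = true
      rw [h2, rectPattern_one, rectPattern_one, toAdd_mul, toAdd_ofAdd, zmod2_add_neg_one]
    · show rectPattern k 1 ((i, a, e) * (rectTwist k 3)⁻¹) = true ↔
        (!rectPattern k 1 (i, a, e)) = true
      rw [h3, rectPattern_one, rectPattern_one, toAdd_mul, toAdd_ofAdd, zmod2_add_neg_one]

omit [NeZero k] in
/-- `1 ≠ 0`, `2 ≠ 0`, `-1 ≠ 0` in `ℤ/k` for `k ≥ 3`. -/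
theorem zmodk_facts (hk : 3 ≤ k) :
    (1 : ZMod k) ≠ 0 ∧ (2 : ZMod k) ≠ 0 ∧ (-1 : ZMod k) ≠ 0 := by
  have h1 : (1 : ZMod k) ≠ 0 := by
    intro h
    have := (ZMod.natCast_eq_zero_iff 1 k).1 (by simpa using h)
    exact absurd (Nat.le_of_dvd one_pos this) (by omega)
  have h2 : (2 : ZMod k) ≠ 0 := by
    intro h
    have := (ZMod.natCast_eq_zero_iff 2 k).1 (by rw [Nat.cast_two]; exact h)
    exact absurd (Nat.le_of_dvd two_pos this) (by omega)
  exact ⟨h1, h2, neg_ne_zero.2 h1⟩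

omit [NeZero k] in
/-- No conjugate pair: for no pair of twist indices `i, j` is `Ψ_l · (t j)⁻¹ = Ψ_l · c · (t i)⁻¹` for ALL
labels `l` — type B breaks `uc`, type A breaks `vc`, `uvc`, `v⁻¹c`, `u v⁻¹ c` (at the points `a = 0, 1, 0, 2`
of `⟨w⟩`), and the CM condition breaks `c`. -/
theorem rectPattern_noConj (hk : 3 ≤ k) : ∀ i j : Fin 4,
    ¬ ∀ (l : Fin 2) (p : PR k), (rectPattern k l (p * (rectTwist k j)⁻¹) = true ↔
      rectPattern k l (p * (rectConj k * (rectTwist k i)⁻¹)) = true) := by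
  obtain ⟨f1, f2, fm1⟩ := zmodk_facts k hk
  have f21 : (2 : ZMod k) + -1 = 1 := by rw [← one_add_one_eq_two, add_neg_cancel_right]
  have z1 : ((1 : ZMod 2) + 1) = 0 := by decide
  have z2 : (-1 : ZMod 2) = 1 := by decide
  have z01 : (0 : ZMod 2) ≠ 1 := by decide
  intro i j h
  -- the equivalence at `p = q · t j`: `Ψ_l q ↔ Ψ_l (q · D)`, `D = t j · c · (t i)⁻¹`
  have h' : ∀ (l : Fin 2) (q : PR k), (rectPattern k l q = true ↔
      rectPattern k l (q * (rectTwist k j * (rectConj k * (rectTwist k i)⁻¹))) = true) := by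
    intro l q
    have := h l (q * rectTwist k j)
    rwa [mul_inv_cancel_right, mul_assoc] at this
  fin_cases i <;> fin_cases j
  · -- (i, j) = (0, 0)
    have := h' 1 (1, 1, 1)
    simp [rectTwist, rectConj, rectPattern_one, z01] at this
  · -- (i, j) = (0, 1)
    have := h' 1 (1, 1, 1)
    simp [rectTwist, rectConj, rectPattern_one, z01] at this
  · -- (i, j) = (0, 2)
    have := h' 0 (1, 1, 1)
    simp [rectTwist, rectConj, rectPattern_zero, f1, z1, z01] at this
  · -- (i, j) = (0, 3)
    have := h' 0 (1, Multiplicative.ofAdd 1, 1)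
    simp [rectTwist, rectConj, rectPattern_zero, f1, f2, z1, z01, one_add_one_eq_two] at this
  · -- (i, j) = (1, 0)
    have := h' 1 (1, 1, 1)
    simp [rectTwist, rectConj, rectPattern_one, z01] at this
  · -- (i, j) = (1, 1)
    have := h' 1 (1, 1, 1)
    simp [rectTwist, rectConj, rectPattern_one, z01] at this
  · -- (i, j) = (1, 2)
    have := h' 0 (1, Multiplicative.ofAdd 1, 1)
    simp [rectTwist, rectConj, rectPattern_zero, f1, f2, z1, z2, z01, one_add_one_eq_two] at this
  · -- (i, j) = (1, 3)
    have := h' 0 (1, 1, 1)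
    simp [rectTwist, rectConj, rectPattern_zero, f1, z1, z01] at this
  · -- (i, j) = (2, 0)
    have := h' 0 (1, 1, 1)
    simp [rectTwist, rectConj, rectPattern_zero, fm1, z01] at this
  · -- (i, j) = (2, 1)
    have := h' 0 (1, Multiplicative.ofAdd (1 + 1), 1)
    simp [rectTwist, rectConj, rectPattern_zero, f1, f2, z01, one_add_one_eq_two, f21] at this
  · -- (i, j) = (2, 2)
    have := h' 1 (1, 1, 1)
    simp [rectTwist, rectConj, rectPattern_one, z01] at this
  · -- (i, j) = (2, 3)
    have := h' 1 (1, 1, 1)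
    simp [rectTwist, rectConj, rectPattern_one, z01] at this
  · -- (i, j) = (3, 0)
    have := h' 0 (1, Multiplicative.ofAdd (1 + 1), 1)
    simp [rectTwist, rectConj, rectPattern_zero, f1, f2, z2, z01, one_add_one_eq_two, f21] at this
  · -- (i, j) = (3, 1)
    have := h' 0 (1, 1, 1)
    simp [rectTwist, rectConj, rectPattern_zero, fm1, z01] at this
  · -- (i, j) = (3, 2)
    have := h' 1 (1, 1, 1)
    simp [rectTwist, rectConj, rectPattern_one, z01] at this
  · -- (i, j) = (3, 3)
    have := h' 1 (1, 1, 1)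
    simp [rectTwist, rectConj, rectPattern_one, z01] at this

/-- **The involution-rectangle mechanism for every odd `k ≥ 3` exists from degree `8k` on.**  For every finite
`(G, c)`, every involution `u ∉ {1, c}` and every `w` of odd order `k ≥ 3` commuting with `u`: if `8k ≤ |G|`,
some CM type `Φ` has `Φ, Φu, Φ(wc), Φ(uwc)` `SumTwo` without a conjugate pair (`v = wc` has order `2k`,
`v^k = c`, and `Δ = {1, u, v, uv}` is a coset of no subgroup). -/
theorem exists_rectQuad_odd [Fintype G] [DecidableEq G] {c : G} (hc : IsComplexConj c) {u w : G}
    (hu : u * u = 1) (hw : orderOf w = k) (huw : u * w = w * u) (hu1 : u ≠ 1) (huc : u ≠ c)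
    (hk : 3 ≤ k) (hodd : Odd k) (hG : 8 * k ≤ Fintype.card G) :
    ∃ Φ : Finset G, IsCMType c Φ ∧ SumTwo (rectQuad Φ u w c) ∧
      ∀ i j : Fin 4, rectQuad Φ u w c j ≠ c • rectQuad Φ u w c i := by
  have hcard : Fintype.card (Fin 2) * Fintype.card (PR k) ≤ Fintype.card G := by
    rw [Fintype.card_fin, Fintype.card_prod, Fintype.card_prod, Fintype.card_multiplicative,
      Fintype.card_multiplicative, ZMod.card, ZMod.card]
    omega
  obtain ⟨Φ, h1, h2, h3⟩ := exists_quad_of_pattern (rectHom k hc hu hw huw)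
    (rectHom_injective k hodd hc hu hw huw hu1 huc) hc (rectHom_conj k hc hu hw huw)
    (rectTwist k) (rectPattern k) (rectPattern_conj k) (rectPattern_card k) (rectPattern_noConj k hk)
    hcard
  refine ⟨Φ, h1, ?_, ?_⟩
  · rw [rectQuad_eq_twists_odd k (by omega) Φ hc hu hw huw]; exact h2
  · rw [rectQuad_eq_twists_odd k (by omega) Φ hc hu hw huw]; exact h3

end RectOdd

end HodgeRepro.CosetQuad
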